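import Literature.AlgebraicGeometry.ShimuraVarieties.UnitaryAuxiliaryReflexTransport   -- ★ degree-one transport (`absClosureEmbedding_bijective`, `absGaloisRestrictAb_injective_of_bijective`, …)
import Literature.NumberTheory.AdelicBaseChange.IdeleConormIdeals                      -- ★ `finiteIdeleConorm`, `finiteIdeleRelNorm_finiteIdeleConorm`, `count_extendedHom`
import Literature.NumberTheory.AdelicBaseChange.AutomorphicCompat                       -- ★ `finiteAdeleRing_mapSemialgHom_apply_eq_baseChange`
import Literature.NumberTheory.Automorphic.AdeleBaseChange                              -- ★ `FiniteAdeleRing.baseChange_apply`, `valued_adicCompletionOfLiesOver`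
import Literature.NumberTheory.NumberFields.CyclotomicCharacterIdele                     -- ★ `count_coe_eq_modulusExp`
import Literature.NumberTheory.NumberFields.FiniteIdeleSubgroupIdealGroup                -- ★ `IdeleAction.trivialAt`
import HarnessLib

/-!
# The CONORM as the degree-one reflex transport: Artin correspondents, components, congruences
# ([Cassels–Fröhlich] II §19 (19.2), (19.20)–(19.21); VII Prop. 4.3; [Milne 2005] (59), Rem. 12.9)

Topic `AlgebraicGeometry/ShimuraVarieties` + `NumberTheory/AdelicBaseChange`; namespaces `Literature.NumberTheory.AdelicBaseChange` (§1, the conorm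
`con_{L/K} : J_{K,f} → J_{L,f}` componentwise) and `Literature.AlgebraicGeometry.ShimuraVarieties.UnitaryCanonicalModel.Aux` (§2, the reflex tower).
THEOREMS ONLY (no definition, no named fact, no instance, no notation, no `sorry`; net debt 0).  Cell `hodgecm-mathlib`, FLOOR 0, P6 «MOD programme»
(crux hLiu418 = stmt-HodgeConjecture-24832, `--supports`), X-LEAF sheet line, (S8) closer `stub_ESHEET`, organ (S6)⊕(S7) `stub_TWIST` («L4» DEAL #30,
LA4-p05 (g4)): the junction `IsSheetTwistOf` wants an `E♯`-IDÈLE Artin correspondent `sE` (`E♯ = Aux.reflexField F Φ′ ι₁ = ι₁(F)` for `F ∕ ℚ` Galois) whose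
reflex norm `t(sE)` has a PRESCRIBED ideal and a PRESCRIBED congruence `≡ 1 mod (N)`, while the Artin correspondents the tree produces with known
ideal and congruence are `F`-idèles (★ `LocalFrobeniusArtinCorrespondent.exists_isArtinCorrespondent_of_isAbsArithFrob`: `(ϖ_w⁻¹)_w`; ★
`Theorems/F0P6aTwistDataCoprime.exists_isArtinCorrespondent_splitPrime_congr`: a split prime `≡ 1 mod 𝔪`).  ★ `UnitaryAuxiliaryReflexTransport`
moves the Artin relation along the degree-one extension `F → E♯` but hides the transported idèle behind `∃ s′, N s′ = s`; this file NAMES it — the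
CONORM `con s` ([CasselsFrohlichANT1967] II §19 (19.2)) — so that its components (`(con s)_w = s_{w∩𝓞_K}` in `L_w`), hence its congruences and its
triviality at the primes of a rational modulus, transfer verbatim.

* §1 (any extension of number fields `K ⊆ L`): `coe_finiteIdeleConorm_apply` (components), `valued_finiteIdeleConorm_apply`
  (`|(con s)_w|_w = |s_v|_v^{e(w|v)}`), `valued_finiteIdeleConorm_apply_sub_one`, `modulusExp_span_natCast_eq_mul_under` (`n_w((M)_L) = e(w|v)·n_v((M)_K)`),
  **`finiteIdeleConorm_congr_at_primes_natCast`** (`s ≡ 1 mod (M)` at the primes of `(M)` ⇒ `con s ≡ 1 mod (M)` at the primes of `(M)`, valuation form),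
  `finiteIdeleConorm_mem_trivialAt_span_natCast`.
* §2 (CM field `L`, `HasSmallReflex`): **`isArtinCorrespondent_finiteIdeleConorm_of_hasSmallReflex`** — `s ↔ σ` over `(L, τ)` ⇒ `con_{E♯/L} s ↔ σ` over
  `E♯ ⊂ ℂ` (the proof of ★ `exists_finiteIdele_norm_eq_isArtinCorrespondent_of_hasSmallReflex` with its witness exposed), and
  `finiteIdeleRelNorm_finiteIdeleConorm_of_hasSmallReflex` (`N_{E♯/L}(con s) = s`).

## References
* [CasselsFrohlichANT1967] J. W. S. Cassels, A. Fröhlich (eds.), *Algebraic Number Theory* (1967): Ch. II §19 (19.2), (19.11), (19.20)–(19.21); Ch. VII (Tate) Prop. 4.3.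
* [NeukirchANT1999] J. Neukirch, *Algebraic Number Theory* (1999), Ch. III §1 (1.6) (`i_{L|K}`); Ch. VI §1 Def. (1.7).
* [Milne2005ShimuraVarieties] J. S. Milne, *Introduction to Shimura varieties* (2005), (59) p. 107; Rem. 12.9 p. 115.
HC_CM is proved only modulo the printed citations (2 remaining named inputs hLiu418 24832, h413 24833) until rung 0 closes — count-neutral.
-/

set_option autoImplicit false

noncomputable section

open Function NumberField Field IsDedekindDomain WithZero
open scoped nonZeroDivisors
open Literature.AlgebraicGeometry.Motives
open Literature.NumberTheory.GaloisRepresentations Literature.NumberTheory.NumberFields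
open Literature.NumberTheory.Automorphic (adicCompletionOfUnder adicCompletionOfLiesOver valued_adicCompletionOfLiesOver)
open Literature.NumberTheory.Automorphic.FiniteAdeleRing (toFractionalIdeal)

/-! ### §1. The conorm componentwise; congruences and triviality at the primes of a rational modulus -/

namespace Literature.NumberTheory.AdelicBaseChange

section Components

variable (K L : Type) [Field K] [NumberField K] [Field L] [NumberField L] [Algebra K L]

/-- **Components of the conorm**: `(con_{L/K} s)_w = s_{w ∩ 𝓞_K}` read in `L_w` through `K_{w∩𝓞_K} → L_w` (the packet՚s `mapSemialgHom` is the tree՚s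
`FiniteAdeleRing.baseChange`, whose components are ★ `FiniteAdeleRing.baseChange_apply`). [cite: CasselsFrohlichANT1967, Ch. II §19 (19.2)] -/
theorem coe_finiteIdeleConorm_apply (s : (FiniteAdeleRing (𝓞 K) K)ˣ) (w : HeightOneSpectrum (𝓞 L)) :
    ((finiteIdeleConorm K L s : (FiniteAdeleRing (𝓞 L) L)ˣ) : FiniteAdeleRing (𝓞 L) L) w =
      adicCompletionOfUnder (𝓞 K) K L w ((s : FiniteAdeleRing (𝓞 K) K) (w.under (𝓞 K))) := by
  rw [coe_finiteIdeleConorm, finiteAdeleRing_mapSemialgHom_apply_eq_baseChange]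
  rfl

/-- **`|(con s)_w|_w = |s_v|_v^{e(w|v)}`**, `v = w ∩ 𝓞_K` ([CasselsFrohlichANT1967] (19.21) `|π_v|_V = |Π_V|_V^{e_V}`; ★ `valued_adicCompletionOfLiesOver`).
[cite: CasselsFrohlichANT1967, Ch. II §19 (19.20)–(19.21)] -/
theorem valued_finiteIdeleConorm_apply (s : (FiniteAdeleRing (𝓞 K) K)ˣ) (w : HeightOneSpectrum (𝓞 L)) :
    Valued.v (((finiteIdeleConorm K L s : (FiniteAdeleRing (𝓞 L) L)ˣ) : FiniteAdeleRing (𝓞 L) L) w) =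
      Valued.v ((s : FiniteAdeleRing (𝓞 K) K) (w.under (𝓞 K))) ^ (w.under (𝓞 K)).asIdeal.ramificationIdx' w.asIdeal := by
  rw [coe_finiteIdeleConorm_apply]
  exact @valued_adicCompletionOfLiesOver (𝓞 K) K L (𝓞 L) _ _ _ _ _ _ _ _ _ _ _ _ _ _ _ _ (w.under (𝓞 K)) w ⟨rfl⟩ _

/-- **`|(con s)_w − 1|_w = |s_v − 1|_v^{e(w|v)}`** (`K_v → L_w` is a ring map). [cite: CasselsFrohlichANT1967, Ch. II §19 (19.2), (19.21)] -/
theorem valued_finiteIdeleConorm_apply_sub_one (s : (FiniteAdeleRing (𝓞 K) K)ˣ) (w : HeightOneSpectrum (𝓞 L)) :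
    Valued.v (((finiteIdeleConorm K L s : (FiniteAdeleRing (𝓞 L) L)ˣ) : FiniteAdeleRing (𝓞 L) L) w - 1) =
      Valued.v ((s : FiniteAdeleRing (𝓞 K) K) (w.under (𝓞 K)) - 1) ^ (w.under (𝓞 K)).asIdeal.ramificationIdx' w.asIdeal := by
  rw [coe_finiteIdeleConorm_apply, ← map_one (adicCompletionOfUnder (𝓞 K) K L w), ← map_sub]
  exact @valued_adicCompletionOfLiesOver (𝓞 K) K L (𝓞 L) _ _ _ _ _ _ _ _ _ _ _ _ _ _ _ _ (w.under (𝓞 K)) w ⟨rfl⟩ _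

omit [NumberField K] [NumberField L] in
/-- A prime of `L` containing the rational modulus `M` lies over a prime of `K` containing `M`. [cite: NeukirchANT1999, Ch. I §8] -/
theorem span_natCast_le_under_of_le (M : ℕ) {w : HeightOneSpectrum (𝓞 L)} (hw : Ideal.span {(M : 𝓞 L)} ≤ w.asIdeal) :
    Ideal.span {(M : 𝓞 K)} ≤ (w.under (𝓞 K)).asIdeal := by
  rw [Ideal.span_singleton_le_iff_mem] at hw ⊢
  change (M : 𝓞 K) ∈ w.asIdeal.comap (algebraMap (𝓞 K) (𝓞 L))
  rw [Ideal.mem_comap, map_natCast]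
  exact hw

/-- **`n_w((M)_L) = e(w|v) · n_v((M)_K)`** for a rational modulus `M ≠ 0` (Neukirch՚s `i_{L|K}(∏ 𝔭^{ν_𝔭}) = ∏ 𝔓^{e ν_𝔭}` at `(M) = i_{L|K}((M))`; ★
`count_extendedHom`, ★ `count_coe_eq_modulusExp`). [cite: NeukirchANT1999, Ch. III §1 (i_{L|K}); Ch. VI §1 Def. (1.7)] [cite: CasselsFrohlichANT1967, Ch. II §19 (19.20)] -/
theorem modulusExp_span_natCast_eq_mul_under {M : ℕ} (hM : M ≠ 0) (w : HeightOneSpectrum (𝓞 L)) :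
    (modulusExp (Ideal.span {(M : 𝓞 L)}) w : ℤ) =
      (w.asIdeal.ramificationIdx (𝓞 K) : ℤ) * (modulusExp (Ideal.span {(M : 𝓞 K)}) (w.under (𝓞 K)) : ℤ) := by
  have hMK : (Ideal.span {(M : 𝓞 K)} : Ideal (𝓞 K)) ≠ ⊥ := by
    rw [Ne, Ideal.span_singleton_eq_bot]; exact_mod_cast hM
  have hML : (Ideal.span {(M : 𝓞 L)} : Ideal (𝓞 L)) ≠ ⊥ := by
    rw [Ne, Ideal.span_singleton_eq_bot]; exact_mod_cast hM
  have hext : FractionalIdeal.extendedHom L (𝓞 L) ((Ideal.span {(M : 𝓞 K)} : Ideal (𝓞 K)) : FractionalIdeal (𝓞 K)⁰ K) =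
      ((Ideal.span {(M : 𝓞 L)} : Ideal (𝓞 L)) : FractionalIdeal (𝓞 L)⁰ L) := by
    rw [FractionalIdeal.coeIdeal_span_singleton, FractionalIdeal.coeIdeal_span_singleton, map_natCast,
      extendedHom_spanSingleton_algebraMap, map_natCast, map_natCast]
  rw [← count_coe_eq_modulusExp hML w, ← count_coe_eq_modulusExp hMK (w.under (𝓞 K)), ← hext,
    count_extendedHom K L (FractionalIdeal.coeIdeal_ne_zero.2 hMK) w]

/-- **THE CONORM PRESERVES `≡ 1 mod (M)` READ AT THE PRIMES OF `(M)`** (valuation form of the sheet line): if `|s_v|_v = 1` and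
`|s_v − 1|_v ≤ exp(−n_v((M)))` at every prime `v ⊇ (M)` of `K`, then `|(con s)_w|_w = 1` and `|(con s)_w − 1|_w ≤ exp(−n_w((M)))` at every prime
`w ⊇ (M)` of `L` (`(con s)_w = s_v` in `L_w`, valuations raised to `e(w|v)`, and `n_w = e(w|v) n_v`).
[cite: CasselsFrohlichANT1967, Ch. II §19 (19.2), (19.20)–(19.21)] [cite: NeukirchANT1999, Ch. VI §1 Def. (1.7) p. 363] -/
theorem finiteIdeleConorm_congr_at_primes_natCast {M : ℕ} (hM : M ≠ 0) {s : (FiniteAdeleRing (𝓞 K) K)ˣ}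
    (hs : ∀ v : HeightOneSpectrum (𝓞 K), Ideal.span {(M : 𝓞 K)} ≤ v.asIdeal →
      Valued.v ((s : FiniteAdeleRing (𝓞 K) K) v) = 1 ∧
      Valued.v ((s : FiniteAdeleRing (𝓞 K) K) v - 1) ≤ exp (-(modulusExp (Ideal.span {(M : 𝓞 K)}) v : ℤ))) :
    ∀ w : HeightOneSpectrum (𝓞 L), Ideal.span {(M : 𝓞 L)} ≤ w.asIdeal →
      Valued.v (((finiteIdeleConorm K L s : (FiniteAdeleRing (𝓞 L) L)ˣ) : FiniteAdeleRing (𝓞 L) L) w) = 1 ∧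
      Valued.v (((finiteIdeleConorm K L s : (FiniteAdeleRing (𝓞 L) L)ˣ) : FiniteAdeleRing (𝓞 L) L) w - 1) ≤
        exp (-(modulusExp (Ideal.span {(M : 𝓞 L)}) w : ℤ)) := by
  intro w hw
  obtain ⟨h1, h2⟩ := hs (w.under (𝓞 K)) (span_natCast_le_under_of_le K L M hw)
  haveI : w.asIdeal.LiesOver (w.under (𝓞 K)).asIdeal := ⟨rfl⟩
  have he : (w.under (𝓞 K)).asIdeal.ramificationIdx' w.asIdeal = w.asIdeal.ramificationIdx (𝓞 K) :=
    Ideal.ramificationIdx'_eq_ramificationIdx _ _ (w.under (𝓞 K)).ne_bot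
  refine ⟨by rw [valued_finiteIdeleConorm_apply, h1, one_pow], ?_⟩
  rw [valued_finiteIdeleConorm_apply_sub_one, modulusExp_span_natCast_eq_mul_under K L hM w, he]
  calc Valued.v ((s : FiniteAdeleRing (𝓞 K) K) (w.under (𝓞 K)) - 1) ^ w.asIdeal.ramificationIdx (𝓞 K)
      ≤ exp (-(modulusExp (Ideal.span {(M : 𝓞 K)}) (w.under (𝓞 K)) : ℤ)) ^ w.asIdeal.ramificationIdx (𝓞 K) :=
        pow_le_pow_left' h2 _
    _ = exp (-((w.asIdeal.ramificationIdx (𝓞 K) : ℤ) * (modulusExp (Ideal.span {(M : 𝓞 K)}) (w.under (𝓞 K)) : ℤ))) := by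
        rw [← exp_nsmul, nsmul_eq_mul, mul_neg]

/-- **The conorm of an idèle trivial at the primes of `(M)` is trivial at the primes of `(M)`** (`(con s)_w = s_v = 1`).
[cite: CasselsFrohlichANT1967, Ch. II §19 (19.2)] [cite: NeukirchANT1999, Ch. VI §1 (1.9)] -/
theorem finiteIdeleConorm_mem_trivialAt_span_natCast (M : ℕ) {s : (FiniteAdeleRing (𝓞 K) K)ˣ}
    (hs : s ∈ IdeleAction.trivialAt (K := K) (Ideal.span {(M : 𝓞 K)})) :
    finiteIdeleConorm K L s ∈ IdeleAction.trivialAt (K := L) (Ideal.span {(M : 𝓞 L)}) := by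
  intro w hw
  rw [coe_finiteIdeleConorm_apply, hs (w.under (𝓞 K)) (span_natCast_le_under_of_le K L M hw), map_one]

end Components

end Literature.NumberTheory.AdelicBaseChange

/-! ### §2. The reflex tower `τL ⊆ E♯` in degree one: `con_{E♯/L} s` IS the transported Artin correspondent -/

namespace Literature.AlgebraicGeometry.ShimuraVarieties

namespace UnitaryCanonicalModel

namespace Aux

open Literature.NumberTheory.AdelicBaseChange (finiteIdeleRelNorm finiteAdeleRelNorm ideleRelNorm finiteIdeleConorm
  finiteAdeleRelNorm_mapSemialgHom coe_finiteIdeleRelNorm val_ideleRelNorm_snd finiteIdeleRelNorm_finiteIdeleConorm)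

/-- **Degree one: `N_{E♯/L}(con_{E♯/L} s) = s`** for `E♯ = τ(L)` (`HasSmallReflex`), by `N(con x) = x^{[E♯:L]}` (★ `finiteIdeleRelNorm_finiteIdeleConorm`) and
`[E♯ : L] = 1`. [cite: CasselsFrohlichANT1967, Ch. II §19 (19.11)] -/
theorem finiteIdeleRelNorm_finiteIdeleConorm_of_hasSmallReflex
    (L : Type) [Field L] [NumberField L] [IsCMField L] (Φ : CMType L) (τ : L →+* ℂ) (hsm : Aux.HasSmallReflex L Φ τ) :
    (haveI : NumberField ↥(Aux.reflexField L Φ τ) := Aux.numberField_reflexField L Φ τ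
     letI : Algebra L ↥(Aux.reflexField L Φ τ) := (Aux.toReflexField L Φ τ).toAlgebra
     ∀ s : (FiniteAdeleRing (𝓞 L) L)ˣ,
       finiteIdeleRelNorm L ↥(Aux.reflexField L Φ τ) (finiteIdeleConorm L ↥(Aux.reflexField L Φ τ) s) = s) := by
  intro s
  haveI : NumberField ↥(reflexField L Φ τ) := numberField_reflexField L Φ τ
  letI : Algebra L ↥(reflexField L Φ τ) := (toReflexField L Φ τ).toAlgebra
  have hφ : Function.Surjective (algebraMap L ↥(reflexField L Φ τ)) := by
    intro x
    have hx : (x : ℂ) ∈ τ.toRatAlgHom.fieldRange := by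
      rw [← reflexField_eq_of_hasSmallReflex L hsm]
      exact x.2
    obtain ⟨l, hl⟩ := AlgHom.mem_fieldRange.1 hx
    exact ⟨l, Subtype.ext hl⟩
  have h1 : Module.finrank L ↥(reflexField L Φ τ) = 1 := by
    rw [← (AlgEquiv.ofBijective (Algebra.ofId L ↥(reflexField L Φ τ))
      ⟨(algebraMap L ↥(reflexField L Φ τ)).injective, hφ⟩).toLinearEquiv.finrank_eq, Module.finrank_self]
  rw [finiteIdeleRelNorm_finiteIdeleConorm, h1, pow_one]

/-- **REFLEX TRANSPORT BY THE CONORM (degree one)**: if `E*(Φ) ⊆ τ(L)` (`Aux.HasSmallReflex`, so `τ : L ≅ E♯ = Aux.reflexField L Φ τ`) and the finite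
idèle `s` of `L` is an Artin correspondent of `σ ∈ Aut(ℂ)` along `τ` ([Milne2005ShimuraVarieties] (59)), then ITS CONORM `con_{E♯/L} s` is an Artin
correspondent of the same `σ` over `E♯ ⊂ ℂ`.  This is ★ `exists_finiteIdele_norm_eq_isArtinCorrespondent_of_hasSmallReflex` with its witness named (same
proof: `σ|_{Ē♯} = ι γ ι⁻¹` along `e ∘ ι⁻¹`, and in `Γ_L^ab`, where `res^ab` is injective, `res^ab θ_{E♯}((1, con s)) = θ_L(N(1, con s)) = θ_L((1, s))`
by Tate VII 4.3 and `N(con s) = s`) — the consumers of the sheet line need the witness, because its components, ideal and congruences are those of `s`.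
[cite: Milne2005ShimuraVarieties, (59) p. 107; Rem. 12.9 p. 115] [cite: CasselsFrohlichANT1967, Ch. VII Prop. 4.3; Ch. II §19 (19.2), (19.11)] -/
theorem isArtinCorrespondent_finiteIdeleConorm_of_hasSmallReflex
    (L : Type) [Field L] [NumberField L] [IsCMField L] (Φ : CMType L) (τ : L →+* ℂ) (hsm : Aux.HasSmallReflex L Φ τ) :
    (haveI : NumberField ↥(Aux.reflexField L Φ τ) := Aux.numberField_reflexField L Φ τ
     letI : Algebra L ↥(Aux.reflexField L Φ τ) := (Aux.toReflexField L Φ τ).toAlgebra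
     ∀ (σ : ℂ ≃+* ℂ) (s : (FiniteAdeleRing (𝓞 L) L)ˣ), UnitaryCanonicalModel.IsArtinCorrespondent L τ s σ →
       UnitaryCanonicalModel.IsArtinCorrespondent ↥(Aux.reflexField L Φ τ)
         (algebraMap ↥(Aux.reflexField L Φ τ) ℂ) (finiteIdeleConorm L ↥(Aux.reflexField L Φ τ) s) σ) := by
  intro σ s h
  haveI : NumberField ↥(reflexField L Φ τ) := numberField_reflexField L Φ τ
  letI : Algebra L ↥(reflexField L Φ τ) := (toReflexField L Φ τ).toAlgebra
  -- (1) degree one: `τ : L → E♯` is onto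
  have hφ : Function.Surjective (algebraMap L ↥(reflexField L Φ τ)) := by
    intro x
    have hx : (x : ℂ) ∈ τ.toRatAlgHom.fieldRange := by
      rw [← reflexField_eq_of_hasSmallReflex L hsm]
      exact x.2
    obtain ⟨l, hl⟩ := AlgHom.mem_fieldRange.1 hx
    exact ⟨l, Subtype.ext hl⟩
  haveI : Module.Finite L ↥(reflexField L Φ τ) := Module.Finite.of_surjective (Algebra.linearMap L _) hφ
  haveI : Algebra.IsAlgebraic L ↥(reflexField L Φ τ) := Algebra.IsAlgebraic.of_finite L _
  -- (2) the conorm and `N (con s) = s`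
  set s' : (FiniteAdeleRing (𝓞 ↥(reflexField L Φ τ)) ↥(reflexField L Φ τ))ˣ := finiteIdeleConorm L ↥(reflexField L Φ τ) s with hs'def
  have hs' : finiteIdeleRelNorm L ↥(reflexField L Φ τ) s' = s :=
    finiteIdeleRelNorm_finiteIdeleConorm_of_hasSmallReflex L Φ τ hsm s
  -- (3) the Galois data of the hypothesis
  letI : Algebra L ℂ := τ.toAlgebra
  obtain ⟨e, γ, he, hγ⟩ := h
  -- (4) `γ♯ := res⁻¹ γ`, `ι : L̄ ≅ Ē♯`
  have hres : Function.Bijective (absGaloisRestrict L ↥(reflexField L Φ τ)) :=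
    ⟨absGaloisRestrict_injective L _, absGaloisRestrict_surjective_of_surjective L _ hφ⟩
  obtain ⟨γ', hγ'⟩ := hres.2 γ
  let ιe : AlgebraicClosure L ≃ₐ[L] AlgebraicClosure ↥(reflexField L Φ τ) :=
    AlgEquiv.ofBijective (absClosureEmbedding L _) (absClosureEmbedding_bijective L _)
  have hιe : ∀ x, ιe x = absClosureEmbedding L ↥(reflexField L Φ τ) x := fun _ => rfl
  have hsmul : ∀ x, γ' • ιe x = ιe (γ • x) := fun x => by
    rw [hιe, hιe, ← absGaloisRestrict_apply_smul, hγ']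
  -- (5) `e♯ := e ∘ ι⁻¹`, an `E♯`-embedding `Ē♯ → ℂ`
  letI : Algebra ↥(reflexField L Φ τ) ℂ := (algebraMap ↥(reflexField L Φ τ) ℂ).toAlgebra
  let e' : AlgebraicClosure ↥(reflexField L Φ τ) →ₐ[↥(reflexField L Φ τ)] ℂ :=
    { toRingHom := e.toRingHom.comp ιe.symm.toRingEquiv.toRingHom
      commutes' := by
        intro x
        obtain ⟨l, rfl⟩ := hφ x
        change e (ιe.symm (algebraMap ↥(reflexField L Φ τ) (AlgebraicClosure ↥(reflexField L Φ τ))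
          (algebraMap L ↥(reflexField L Φ τ) l))) = _
        rw [← IsScalarTower.algebraMap_apply L ↥(reflexField L Φ τ) (AlgebraicClosure ↥(reflexField L Φ τ)) l,
          ιe.symm.commutes, e.commutes]
        rfl }
  have he' : ∀ z, e' z = e (ιe.symm z) := fun _ => rfl
  refine ⟨e', γ', fun z => ?_, ?_⟩
  · -- `σ|_{Ē♯} = γ♯` along `e♯`
    obtain ⟨x, rfl⟩ := ιe.surjective z
    change e' (γ' • ιe x) = σ (e' (ιe x))
    rw [hsmul, he', he', ιe.symm_apply_apply, ιe.symm_apply_apply]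
    exact he x
  · -- the Artin relation, compared in `Γ_L^ab` through the injective `res^ab`
    apply absGaloisRestrictAb_injective_of_bijective L ↥(reflexField L Φ τ) hres
    rw [absGaloisRestrictAb_mk, hγ', hγ, map_inv, inv_inj, finiteIdeleClass, finiteIdeleClass,
      ← ideleArtinMap_apply, ← ideleArtinMap_apply, absGaloisRestrictAb_ideleArtinMap]
    refine ideleArtinMap_eq_of_snd_eq ?_
    rw [val_ideleRelNorm_snd, Units.coe_map, Units.coe_map, MonoidHom.inr_apply, MonoidHom.inr_apply]
    change (s : FiniteAdeleRing (𝓞 L) L) = finiteAdeleRelNorm L ↥(reflexField L Φ τ) (s' : FiniteAdeleRing _ _)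
    rw [← coe_finiteIdeleRelNorm, hs']

end Aux

end UnitaryCanonicalModel

end Literature.AlgebraicGeometry.ShimuraVarieties

end
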